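import Summits.Ventures.HodgeRepro.FaceCensusEngine

/-!
# Galois twists of type squares: stabilisers, fixed points, Burnside (seat `p1`, blind cell `pub-hodge-repro`)

The sealed engine lists the type squares of a Galois CM type `(G, c)` and counts their orbits under the Galois twists
`T ↦ T·g` (right translation).  This file adds the vocabulary that EXPLAINS the orbit numbers of the census
(`1`; `3, 4, 4, 6, 5, 3`; `20, 22, 26, 20`) by the class equation / Burnside:

* `stabilizer S` — the twists fixing the set of types `S`;
* `stabTable sq` — the stabiliser of every square of a list;
* `fixCount st j`, `fixTable st` — the fixed-point table `j ↦ #{S : S·g_j = S}` read off a stabiliser table;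
* `isOtherInvolution j`, `iota` — the involutions of `G` other than `c`, and their number `ι`;
* `fixPred` — the predicted fixed-point count: `#squares` at `j = 1`, `(m/2)·2^((m−2)/2)` (`m = n/2`) at an
  involution other than `c`, and `0` otherwise.

The theorem behind the per-row certificates (paper proof: `proofs/P1.md` §8): for `m ≥ 3` every stabiliser of a
square has order `≤ 2` and its non-trivial element is an involution `g ≠ c` of `G` swapping the two places of the
square; hence the orbits have size `n` or `n/2`, there are `ι·2^(m/2−2)` orbits of size `n/2`, and the number of
orbits is `2^(m−4)(m−1) + ι·2^(m/2−3)`.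
-/

namespace Summit.Ventures.HodgeRepro.FaceCensus.CMGaloisType

variable {n : ℕ} (Γ : CMGaloisType n)

/-- `g_j` is an involution of the table other than the identity and other than complex conjugation `c`. -/
def isOtherInvolution (j : Fin n) : Bool := j != Γ.one && j != Γ.conj && Γ.mul j j == Γ.one

/-- `ι` = the number of involutions of `G` other than `c`. -/
def iota : ℕ := ((List.finRange n).filter Γ.isOtherInvolution).length

/-- The stabiliser of a set of types `S` under the Galois twists: the `j` with `S·g_j = S` (in normal form). -/
def stabilizer (S : List ℕ) : List (Fin n) := (List.finRange n).filter fun j => Γ.twistSet j S == S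

/-- The stabiliser of every square of the list `sq` (same order). -/
def stabTable (sq : List (List ℕ)) : List (List (Fin n)) := sq.map Γ.stabilizer

end Summit.Ventures.HodgeRepro.FaceCensus.CMGaloisType

namespace Summit.Ventures.HodgeRepro.FaceCensus

/-! #### Table-only helpers (independent of the Cayley table, once the stabiliser table is known) -/

/-- The number of squares fixed by `g_j`, read off a stabiliser table. -/
def fixCount {n : ℕ} (st : List (List (Fin n))) (j : Fin n) : ℕ := (st.filter fun s => s.contains j).length

/-- The fixed-point table `j ↦ #{S : S·g_j = S}` of a stabiliser table. -/
def fixTable {n : ℕ} (st : List (List (Fin n))) : List ℕ := (List.finRange n).map (fixCount st)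

/-- The number of squares of the table with a non-trivial stabiliser. -/
def stabilizedCount {n : ℕ} (st : List (List (Fin n))) : ℕ := (st.filter fun s => s.length != 1).length

/-- Burnside's sum `Σ_j #{S : S·g_j = S}` of a stabiliser table. -/
def burnsideSum {n : ℕ} (st : List (List (Fin n))) : ℕ := (fixTable st).sum

end Summit.Ventures.HodgeRepro.FaceCensus

namespace Summit.Ventures.HodgeRepro.FaceCensus.CMGaloisType

variable {n : ℕ} (Γ : CMGaloisType n)

/-- The fixed-point count predicted by the paper proof (`m = n/2` places, `sqLen` squares): `sqLen` at the identity,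
`(m/2)·2^((m−2)/2)` at an involution other than `c`, `0` otherwise. -/
def fixPred (sqLen : ℕ) (j : Fin n) : ℕ :=
  if j == Γ.one then sqLen else if Γ.isOtherInvolution j then (n / 2 / 2) * 2 ^ ((n / 2 - 2) / 2) else 0

/-- Every stabiliser of the table has order `≤ 2` and consists of the identity and involutions other than `c`. -/
def stabilizersSmall (st : List (List (Fin n))) : Bool :=
  st.all fun s => s.length ≤ 2 && s.all fun j => j == Γ.one || Γ.isOtherInvolution j

/-- The number of corners of a square fixed by the twist `j`. -/
def invariantCorners (S : List ℕ) (j : Fin n) : ℕ := (S.filter fun T => Γ.twist j T == T).length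

/-- Lemma 4's shape: every square with stabiliser `{1, g}` has exactly two `g`-invariant corners (the other two are
exchanged by `g`); squares with trivial stabiliser impose nothing.  Input: the squares and their stabiliser table. -/
def symmetricShape (sq : List (List ℕ)) (st : List (List (Fin n))) : Bool :=
  (List.zip sq st).all fun p =>
    p.2.length == 1 || Γ.invariantCorners p.1 ((p.2.filter fun j => j != Γ.one).getD 0 Γ.one) == 2

end Summit.Ventures.HodgeRepro.FaceCensus.CMGaloisType
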